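import Summits.ABC.IUTFork.Cor312Chain
import Summits.ABC.IUTFork.ForkRegions
import HarnessLib

/-!
# [IUTchIII] Corollary 3.12 — readings of the edge, II: possible images, the hull, and LANA's (9-1) (c312 crew, V-b)

Record-only file (D-0012) of the abc-iut cell; TAKES NO SIDE. `Cor312Chain.lean` isolates the content of
the printed proof of [IUTchIII] Cor. 3.12 beyond its cited loci and qualitative observations in the named
edge `RealEdges.inclusion` — (xi-f): from "[the construction of `ℝ_{≤−|log(Θ)|}`] constitutes … a
construction … of `−|log(q)|`" (`Obs.constitutesConstruction`) to "the inclusion `−|log(q)| ∈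
ℝ_{≤−|log(Θ)|}`". This file reads that edge ONE LEVEL DOWN, in Cor. 3.12's own nouns as skel XVII
(`ForkRegions`) types them — a volume container, the possible images `U_λ` of the Θ-pilot object, their
holomorphic hull `U^{hol}` with `−|log(Θ)| := ln ν̄(U^{hol})`, the `q`-pilot image `Q` with `−|log(q)| :=
ln ν̄(Q)` (`Cor312Setting`) — and connects the cell's three printed positions (plan/LLANA-SPEC.md "WHERE
THE FORK ATTACHES"; plan/TRANCHE-T1.md P11) to it:

* `Volumes.ofSetting` — the chain's real data read off a setting; `ofSetting_cor312_iff`: the chain's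
  `Cor312` is skel's `Cor312Setting.Cor312` (`−|log(q)| ≤ −|log(Θ)|`, LANA (8-1), DH (1.1)).
* THE AUTHOR'S EDGE READ AT REGION LEVEL [claim: Mochizuki2012, status: disputed]: if the (xi-f) sentence
  is read as "the `q`-pilot log-volume is one of the possible output log-volumes" (`RepresentedVol`; LANA's
  paraphrase of Step (xi), §8.3 p. 43), or as "`Q` lies in the hull" (`QSubHull`), or as "`Q` IS a possible
  image" (`QIsImage`; (xi-g) "two tautologically equivalent ways to compute the log-volume of the `q`-pilot
  object"), then the real edges hold: `realEdges_of_representedVol_reading`, `…_qSubHull_reading`,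
  `…_qIsImage_reading` (one line each over skel's `cor312_of_representedVol` / `cor312_of_qSubHull`).
* LANA'S EDGE [cite: LANA2026Report, §9 p. 44, §9.2 (9-1) p. 46, §10.5 p. 49]: (9-1) for the carried
  `η`-setting gives the real edges OUTRIGHT, for every reading `O` of the proof's observations
  (`realEdges_of_mainGoal`, via skel `mainGoal_iff_representedVol`) — "we believe that if the problem
  described in the "main goal" below is solved, then Corollary 3.12 … will follow" is a theorem at this
  level; "(9-1) … is not manifestly false. However, we … do not have a proof of (9-1)".
* (LANA's edge at MEASURE level — c312-4 `LanaRss.EtaData.cor312_of_mainGoal`, p404086 — is bridged in a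
  separate small file once skel `ForkEta.Rss` and c312-4 `LanaRss.Rss` no longer collide on the name
  `Summit.ABC.IUTFork.Rss`; INBOX 2026-08-25.)
* CONVERSELY NOTHING: `edge_not_imp_readings` — a finite setting in which the real edges hold (indeed
  `Cor312` holds) while `RepresentedVol` and `QSubHull` both fail; the edge is weaker than each reading
  offered for it (cf. skel `readings_differ`).
* `setting_cor312_of_chain` — loci ∧ chain ∧ (author's reading at region level) ⟹ `Cor312Setting.Cor312`.
* Scholze–Stix's reading is degree-level (which copies of `ℝ` carry `ln ν̄(U^{hol})`): sibling V-a
  `Cor312EdgeDegrees.lean` [cite: ScholzeStix2018, §2.2 pp. 9–10].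

Everything below is a one-to-three-line application of LANDED skel theorems plus one finite witness.
Deliberately NOT here: the construction of the possible images ([IUTchIII] Thm 3.11 (i)–(ii); c312-1
`Thm311Sig`), the hull as an honest operator on tensor packets (c312-3, L-DH D8), any judgement.
-/

noncomputable section

namespace Summit.ABC

namespace IUTFork

namespace Cor312Proof

open Set

/-! ## 1. The chain's real data read off a region-level setting -/

/-- The chain's `Volumes` of a `Cor312Setting` (skel XVII): `−|log(Θ)| := ln ν̄(U^{hol}) ∈ ℝ` (finite: the
setting carries Cor. 3.12's clause "`−|log(Θ)| ∈ ℝ`" as the datum `Uhol_adm`), `−|log(q)| := ln ν̄(Q)`, with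
"`|log(q)| > 0`" as the hypothesis `hq`. [claim: Mochizuki2012, status: disputed] -/
def Volumes.ofSetting (C : Cor312Setting) (hq : C.negAbsLogq < 0) : Volumes where
  negLogTheta := (C.negLogTheta : WithTop ℝ)
  negAbsLogq := C.negAbsLogq
  negAbsLogq_neg := hq

variable (C : Cor312Setting) (hq : C.negAbsLogq < 0)

/-- … finite. [folklore] -/
theorem Volumes.ofSetting_finite : (Volumes.ofSetting C hq).Finite := WithTop.coe_ne_top

/-- … its inclusion is the setting's inequality `ln ν̄(Q) ≤ ln ν̄(U^{hol})`. [folklore] -/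
theorem Volumes.ofSetting_inclusion_iff : (Volumes.ofSetting C hq).Inclusion ↔ C.Cor312 := by
  rw [Volumes.inclusion_iff]
  exact WithTop.coe_le_coe

/-- … and its `Cor312` is skel's `Cor312Setting.Cor312`. [folklore] -/
theorem Volumes.ofSetting_cor312_iff : (Volumes.ofSetting C hq).Cor312 ↔ C.Cor312 := by
  rw [Volumes.cor312_iff, Volumes.ofSetting_inclusion_iff]
  exact ⟨fun h => h.2, fun h => ⟨Volumes.ofSetting_finite C hq, h⟩⟩

/-- The real edges for a setting = "(xi-f)'s observation ⟹ the setting's inequality". [folklore] -/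
theorem realEdges_ofSetting_iff (O : Obs → Prop) :
    RealEdges O (Volumes.ofSetting C hq) ↔ (O .constitutesConstruction → C.Cor312) := by
  constructor
  · intro h hc
    exact (Volumes.ofSetting_inclusion_iff C hq).1 (h.inclusion hc)
  · intro h
    exact ⟨Volumes.ofSetting_finite C hq, fun hc => (Volumes.ofSetting_inclusion_iff C hq).2 (h hc)⟩

/-! ## 2. The author's edge read at region level: three candidate readings, each sufficient -/

/-- Reading the (xi-f) sentence as `RepresentedVol` ("the set of procession-normalized log-volumes of the
admissible output regions contains the `q`-pilot log-volume as one of its possible values", LANA §8.3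
p. 43 paraphrasing Step (xi)) gives the real edges (skel `cor312_of_representedVol`).
[cite: LANA2026Report, §8.3 p. 43] -/
theorem realEdges_of_representedVol_reading {O : Obs → Prop}
    (h : O .constitutesConstruction → C.RepresentedVol) : RealEdges O (Volumes.ofSetting C hq) :=
  (realEdges_ofSetting_iff C hq O).2 fun hc => C.cor312_of_representedVol (h hc)

/-- Reading it as `QSubHull` (the `q`-pilot image lies in the holomorphic hull of the possible images)
gives the real edges (skel `cor312_of_qSubHull`, monotonicity of `ln ν̄`). [claim: Mochizuki2012, status: disputed] -/
theorem realEdges_of_qSubHull_reading {O : Obs → Prop} (h : O .constitutesConstruction → C.QSubHull) :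
    RealEdges O (Volumes.ofSetting C hq) :=
  (realEdges_ofSetting_iff C hq O).2 fun hc => C.cor312_of_qSubHull (h hc)

/-- Reading it as `QIsImage` ((xi-g): "two tautologically equivalent ways to compute the log-volume of the
`q`-pilot object at (1,0)" — the `q`-pilot image IS one of the possible images) gives the real edges.
[claim: Mochizuki2012, status: disputed] -/
theorem realEdges_of_qIsImage_reading {O : Obs → Prop} (h : O .constitutesConstruction → C.QIsImage) :
    RealEdges O (Volumes.ofSetting C hq) :=
  realEdges_of_representedVol_reading C hq fun hc => C.representedVol_of_qIsImage (h hc)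

/-- **Loci ∧ chain ∧ the author's edge at region level ⟹ Cor. 3.12 for the setting.**
[claim: Mochizuki2012, status: disputed] -/
theorem setting_cor312_of_chain {L : Locus → Prop} {O : Obs → Prop} (hL : ∀ c, L c) (hC : Chain L O)
    (h : O .constitutesConstruction → C.RepresentedVol) : C.Cor312 :=
  C.cor312_of_representedVol (h (constitutesConstruction_of_chain hL hC))

/-! ## 3. LANA's edge: (9-1) gives the real edges outright -/

/-- **(9-1) ⟹ the real edges, for every reading of the proof's observations** — LANA's main goal for the
`η`-setting carried by `C` (skel `Cor312Setting.toEtaSetting`, any pointed line `ℝ^val`) is `RepresentedVol`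
(skel `mainGoal_iff_representedVol`), which gives the inequality; the chain is not used. LANA p. 44: "if the
problem described in the "main goal" below is solved, then Corollary 3.12 … will follow" — a theorem at
this level of typing. [cite: LANA2026Report, §9 p. 44, §9.2 (9-1) p. 46] -/
theorem realEdges_of_mainGoal (Rval : PointedLine) (h : (C.toEtaSetting Rval).MainGoal) (O : Obs → Prop) :
    RealEdges O (Volumes.ofSetting C hq) :=
  realEdges_of_representedVol_reading C hq fun _ => (C.mainGoal_iff_representedVol Rval).1 h

/-- … equivalently, (9-1) ⟹ `Cor312Setting.Cor312`. [cite: LANA2026Report, §9 p. 44] -/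
theorem setting_cor312_of_mainGoal (Rval : PointedLine) (h : (C.toEtaSetting Rval).MainGoal) : C.Cor312 :=
  C.cor312_of_representedVol ((C.mainGoal_iff_representedVol Rval).1 h)

/-! ## 4. Conversely nothing: the edge is weaker than every reading offered for it -/

/-- A finite container: carrier `ℕ`, every region admissible, `ln ν̄(A) := 𝟙_A(0) + 𝟙_A(1) − 3` (monotone,
negative on the regions used), hull = identity. [folklore] -/
def negWitnessContainer : VolumeContainer where
  L := ℕ
  Adm _ := True
  logvol A := A.indicator (fun _ => (1 : ℝ)) 0 + A.indicator (fun _ => (1 : ℝ)) 1 - 3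
  logvol_mono _ _ _ _ hAB :=
    sub_le_sub_right (add_le_add (Set.indicator_le_indicator_of_subset hAB (fun _ => zero_le_one) 0)
      (Set.indicator_le_indicator_of_subset hAB (fun _ => zero_le_one) 1)) 3
  hull := ClosureOperator.id (Set ℕ)

/-- One possible image `{0,1}` (`ln ν̄ = −1`), `q`-pilot image `{0,5}` (`ln ν̄ = −2 < 0`). [folklore] -/
def negWitnessSetting : Cor312Setting where
  toVolumeContainer := negWitnessContainer
  Idx := Unit
  U _ := ({0, 1} : Set ℕ)
  U_adm _ := trivial
  Uhol_adm := trivial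
  Q := ({0, 5} : Set ℕ)
  Q_adm := trivial

/-- `ln ν̄({0,1}) = −1` in the witness. [folklore] -/
private theorem negWitness_U : negWitnessContainer.logvol ({0, 1} : Set ℕ) = -1 := by
  simp only [negWitnessContainer, Set.indicator_apply, Set.mem_insert_iff, Set.mem_singleton_iff]
  norm_num

/-- `ln ν̄({0,5}) = −2` in the witness. [folklore] -/
private theorem negWitness_Q : negWitnessContainer.logvol ({0, 5} : Set ℕ) = -2 := by
  simp only [negWitnessContainer, Set.indicator_apply, Set.mem_insert_iff, Set.mem_singleton_iff]
  norm_num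

/-- The hull of the one possible image is `{0,1}` (hull = identity). [folklore] -/
private theorem negWitness_Uhol : negWitnessSetting.Uhol = ({0, 1} : Set ℕ) := by
  show ClosureOperator.id (Set ℕ) (⋃ _ : Unit, ({0, 1} : Set ℕ)) = {0, 1}
  rw [Set.iUnion_const]
  rfl

/-- `−|log(q)| = −2 < 0` in the witness. [folklore] -/
theorem negWitness_hq : negWitnessSetting.negAbsLogq < 0 := by
  show negWitnessContainer.logvol ({0, 5} : Set ℕ) < 0
  rw [negWitness_Q]; norm_num

/-- **The edge does not give back any of the readings**: in the witness the real edges hold for EVERY `O`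
(indeed `Cor312` holds: `−2 ≤ −1`) while `RepresentedVol` fails (`−1 ≠ −2`) and `QSubHull` fails
(`5 ∉ {0,1}`), hence `QIsImage` fails and (9-1) fails. What the three positions dispute — which reading, if
any, [IUTchIII] supplies — is strictly MORE than the inequality. [folklore] -/
theorem edge_not_imp_readings : ∃ (C : Cor312Setting) (hq : C.negAbsLogq < 0),
    (∀ O : Obs → Prop, RealEdges O (Volumes.ofSetting C hq)) ∧ ¬ C.RepresentedVol ∧ ¬ C.QSubHull ∧
      ¬ C.QIsImage ∧ ∀ Rval, ¬ (C.toEtaSetting Rval).MainGoal := by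
  have hcor : negWitnessSetting.Cor312 := by
    show negWitnessContainer.logvol ({0, 5} : Set ℕ) ≤ negWitnessContainer.logvol negWitnessSetting.Uhol
    rw [negWitness_Uhol, negWitness_U, negWitness_Q]; norm_num
  have hrep : ¬ negWitnessSetting.RepresentedVol := by
    rintro ⟨_, h⟩
    change negWitnessContainer.logvol ({0, 1} : Set ℕ) = negWitnessContainer.logvol ({0, 5} : Set ℕ) at h
    rw [negWitness_U, negWitness_Q] at h; norm_num at h
  have hsub : ¬ negWitnessSetting.QSubHull := by
    intro h
    have h5' : (5 : ℕ) ∈ negWitnessSetting.Uhol := h (show (5 : ℕ) ∈ ({0, 5} : Set ℕ) by simp)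
    rw [negWitness_Uhol] at h5'
    have h5 : (5 : ℕ) ∈ ({0, 1} : Set ℕ) := h5'
    simp at h5
  refine ⟨negWitnessSetting, negWitness_hq, fun O => (realEdges_ofSetting_iff _ _ O).2 fun _ => hcor, hrep,
    hsub, fun h => hrep (negWitnessSetting.representedVol_of_qIsImage h), fun Rval h => ?_⟩
  exact hrep ((negWitnessSetting.mainGoal_iff_representedVol Rval).1 h)

end Cor312Proof

end IUTFork

end Summit.ABC

end
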